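import Literature.NumberTheory.GelbartRogawski1991.ThetaTypeNonsplitJacquetModule   -- ★ p826177 typ-T7a (g0): THE N3 LETTER `thetaType_nonsplit_jacquetModule`
import HarnessLib

/-!
# Crux `H413`, programme P2 — ROW «N4-J»: THE JACQUET MODULE OF THE LOCAL THETA TYPE VANISHES IFF `ψθ` DOES NOT OCCUR IN `ω¹`
# (`subsingleton_jacquet_xThetaGqsCM_iff_not_occurs (hN3)`)

Cell hodgecm-mathlib (D-0151), FLOOR 0, crux item H413 = stmt-HodgeConjecture-24833, route of record `HCCMUnconditional`; programme P2, topic T7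
«GR91 §5 local theta dichotomy for the true packet `{πⁿ(ξ_v), πˢ(ξ_v)}`» (`F0/P2/T7a-TREE.md` §5 (3)); desk F0P2-plan (g8) row «N4-J» (2026-08-31).
A count-neutral kernel helper INSIDE the booked print letter N3 ★ `GelbartRogawski1991.thetaType_nonsplit_jacquetModule` [GelbartRogawski1991 §3.2
(3.2.1)–(3.2.3) p. 457; Kudla1986 Thm. 2.8] (★ p826177), taken BY NAME as the hypothesis `hN3`: conjunct (a) of the letter is a `ℂ`-linear
isomorphism `r_N(X_v) ≃ ℱ_v[ψθ]` between the Jacquet module of Liu's local theta type `X_v(μ, ε, χ_f)` read on `U(Φ₃)(L⁺_v)` (★ `xThetaGqsCM`,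
`N`-coinvariants along ★ `cmBorelTriple L 3 v`) and the `ψθ`-weight space of GR's rank-one oscillator representation `ω¹(γ_v, ψ_v)` (★ `lineWeilCM`
at the Witt kernel line ★ `kernelLineCM dV`), and ★ `OccursInLineWeilCM … ψθ` IS «that weight space is `≠ ⊥`» (★ `ThetaDichotomyVocabulary`).  Hence

  `r_N(X_v) = 0 ⟺ ψθ` does not occur in `ω¹(γ_v, ψ_v)`,

stated as `Subsingleton (r_N(X_v)) ↔ ¬ OccursInLineWeilCM …` with the letter's binder telescope VERBATIM.  USE (desk): with ★ N6
`Rogawski1990.u3_isSupercuspidal_iff_jacquet_eq_zero` (Harish-Chandra's criterion) and the transport `isSupercuspidal_piG` it yields N4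
`GR90Prop522_thetaType_supercuspidal_iff` in-house [GelbartRogawski1990 Prop. 5.2.2] — the assembler is a later row.  Lines-free (no `Cruxes.H413.Lines.*`
import); THEOREMS ONLY (no definition, no named fact, no instance, no notation, no `sorry`).  HC_CM is proved only modulo the printed citations until
rung 0 closes; this file proves no letter — it unfolds one.

## Proof
`obtain ⟨e⟩ := (hN3 …).1`; Mathlib `Equiv.subsingleton_congr` moves `Subsingleton` across `e`; Mathlib `Submodule.nontrivial_iff_ne_bot` and
`not_nontrivial_iff_subsingleton` turn `Subsingleton ↥W` into `¬ (W ≠ ⊥)`, which is `¬ OccursInLineWeilCM …` by `Iff.rfl`.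

## References
- [GelbartRogawski1991] S. Gelbart, J. Rogawski, *L-functions and Fourier–Jacobi coefficients for the unitary group U(3)*, Invent. Math. 105 (1991) — §3.2 (3.2.1)–(3.2.3) p. 457; §5.2 p. 467.
- [GelbartRogawski1990] S. Gelbart, J. Rogawski, *Exceptional representations and Shimura's integral for the local unitary group U(3)*, Festschrift Piatetski-Shapiro (1990) — Prop. 5.2.2.
- [Kudla1986] S. Kudla, *On the local theta-correspondence*, Invent. Math. 83 (1986) — Thm. 2.8.
-/

set_option autoImplicit false
-- the mandated namespace has the single-problem summit's repeated segment (`HodgeConjecture.HodgeConjecture`)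
set_option linter.dupNamespace false

noncomputable section

open NumberField IsDedekindDomain MeasureTheory
open scoped Matrix Kronecker

open Literature.NumberTheory Literature.NumberTheory.Automorphic Literature.NumberTheory.Automorphic.UnitaryGroup
open Literature.NumberTheory.Automorphic.IdeleClassGroup
open Literature.NumberTheory.Automorphic.Liu2021 Literature.NumberTheory.Automorphic.Liu2021.Def411WeilCarriers
open Literature.NumberTheory.GaloisRepresentations
open Literature.NumberTheory.Rogawski1990
open Literature.NumberTheory.GelbartRogawski1991
open Literature.RepresentationTheory

namespace Summit.HodgeConjecture.HodgeConjecture.Cruxes.H413.F0P2oThetaJacquetVanishingIffNotOccurs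

set_option synthInstance.maxHeartbeats 400000 in
set_option maxHeartbeats 8000000 in
/-- **N4-J — `r_N(X_v) = 0 ⟺ ψθ` DOES NOT OCCUR IN `ω¹(γ_v, ψ_v)`** (the N3 letter's conjunct (a) unfolded; binders = ★ `thetaType_nonsplit_jacquetModule`
:100–113 VERBATIM): for every CM field `L`, frame data `(e₁, dV)`, reindexing `e₀`, conjugate-symplectic `μ`, continuous unitary `χ_f`, NON-SPLIT `v`,
line class `ε`, character `ψθ` of `E¹_v` with ★ `IsThetaCenterChar L μ χf ε v ψθ`, and form congruence `ᵗT̄·(diag dV)_v·T = a·Φ₃`, the Jacquet module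
of `X_v(μ, ε, χ_f)` along the Borel of `U(Φ₃)(L⁺_v)` is a subsingleton iff `ψθ` does not occur in the rank-one Weil representation at the Witt kernel line.
[cite: GelbartRogawski1991, §3.2 (3.2.1)–(3.2.3) p. 457; §5.2 p. 467 L8–11] [cite: Kudla1986, Thm. 2.8] [cite: GelbartRogawski1990, Prop. 5.2.2] -/
theorem subsingleton_jacquet_xThetaGqsCM_iff_not_occurs
    (hN3 : Literature.NumberTheory.GelbartRogawski1991.thetaType_nonsplit_jacquetModule) :
  ∀ (L : Type) [Field L] [NumberField L] [IsCMField L]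
    {n' : ℕ} (e₁ : Fin 3 × Fin 1 ≃ Fin n') (dV : Fin 3 → L) (hdV : ∀ i, IsCMField.complexConj L (dV i) = dV i) (hdV0 : ∀ i, dV i ≠ 0)
    {n₀ : ℕ} (e₀ : Fin 1 × Fin 1 ≃ Fin n₀)
    (μ : Literature.NumberTheory.Automorphic.IdeleClassGroup L →ₜ* Circle) (hμ : IsConjugateSymplectic L μ)
    (χf : UnitaryGroup.finAdelicOne (↥(maximalRealSubfield L)) L (IsCMField.complexConj L) →* ℂˣ),
    Continuous χf → (∀ z, ‖((χf z : ℂˣ) : ℂ)‖ = 1) →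
    ∀ (v : HeightOneSpectrum (𝓞 ↥(maximalRealSubfield L))),
      (∀ w : PlacesOver L v, IsCMField.complexConj L • w.1 = w.1) →
      ∀ (ε : (↥(maximalRealSubfield L))ˣ) (ψθ : ↥(normOneUnits (conjLocal L (IsCMField.complexConj L) v)) →* ℂˣ),
        IsThetaCenterChar L μ χf ε v ψθ →
        ∀ (T : GL (Fin 3) (UnitaryGroup.LocalRing L v)) (a : UnitaryGroup.LocalRing L v) (ha : IsUnit a)
          (h : formCongr (conjLocal L (IsCMField.complexConj L) v) T ((Matrix.diagonal dV).map (algebraMap L (UnitaryGroup.LocalRing L v))) =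
            a • (Matrix.of fun i j : Fin 3 => if i.val + j.val + 1 = 3 then (1 : L) else 0).map (algebraMap L (UnitaryGroup.LocalRing L v))),
          Subsingleton (((cmBorelTriple L 3 v).restrict (xThetaGqsCM L e₁ dV hdV hdV0 μ hμ χf ε v T ha h)).Coinvariants) ↔
            ¬ OccursInLineWeilCM L e₀ (kernelLineCM dV) (complexConj_kernelLineCM dV hdV) (kernelLineCM_ne_zero dV hdV0) μ hμ ε v ψθ := by
  intro L _ _ _ n' e₁ dV hdV hdV0 n₀ e₀ μ hμ χf hcont hunit v hv ε ψθ hψ T a ha h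
  obtain ⟨e⟩ := (hN3 L e₁ dV hdV hdV0 e₀ μ hμ χf hcont hunit v hv ε ψθ hψ T a ha h).1
  rw [e.toEquiv.subsingleton_congr, ← not_nontrivial_iff_subsingleton, Submodule.nontrivial_iff_ne_bot]
  exact Iff.rfl

end Summit.HodgeConjecture.HodgeConjecture.Cruxes.H413.F0P2oThetaJacquetVanishingIffNotOccurs

end
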